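/-
Origin: expansion seat `prover-pub-hodgecm-mc-carch-1-g4-0`, handover #CA36 2026-08-20T08:33Z md5 9e4b01e810b8 (234 l., 8 decls; NEW additive leaf; imports #CA33 (this kit) + binder-2 RUN-45 #72 Model.HypCensus.KappaPlace dd5e736e51d0 + installed Model.ArchSlotBoxFock (theta-3 (BF), RUN 44) + Model.ArchLineSlotTypeArch (sinst #1214, RUN 43); RUN 45; INSTALL after #CA33 and binder-2 #72; drop alone; cert certs/ax-ArchKTypeOfSigma-9e4b01e810b8.log: rc 0 / 32 s / 0 warnings / 8/8 trio, #72 built privately from binder-2's staged source) (`HOME/mc/pub-hodgecm-mc-carch-1/pkg45/HodgeCM/Model/ArchKTypeOfSigma.lean`, md5 9e4b01e810b8, 234 lines);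
landed by the gen-17 packager (p-g17) in gate run 45 as `HodgeCM/Model/ArchKTypeOfSigma.lean` (verbatim).
-/
/-
Copyright (c) 2026. Released under Apache 2.0 license as described in the file LICENSE.
Cell pub-hodgecm, MODEL layer (construction prover mc-carch-1, gen 4), BINDER-OWNERS rows 12 / 18 / 19, junction (C-Σ):
the see-saw CONSISTENCY of the definite-place exponents — `pairVacExponent = a₀ + a₁ + ℓ_b`.
-/
import Summits.HodgeConjecture.HodgeCM.Model.ArchKTypeOfLineTables
import Summits.HodgeConjecture.HodgeCM.Model.HypCensus.KappaPlace
import Summits.HodgeConjecture.HodgeCM.Model.ArchSlotBoxFock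
import Summits.HodgeConjecture.HodgeCM.Model.ArchLineSlotTypeArch

/-!
# (C-Σ-def): at a definite place the pair's vacuum exponent is the sum of the two lines' exponents and the see-saw exponent

Rows 12 and 18/19 share ONE `χV`.  Row 12's read-off (#CA33) pins `type χV (w b) = −a₀ b − a₁ b − ℓ_b` (`defExponentZero/One`,
`defLambdaExponent`); binder-2's (V-val) for rows 18/19 (#72 `hκ_lettInv_mulSingle_of_type`) pins `type χV (w b) = −pairVacExponent b`.  This leaf
proves they AGREE:

  **`pairVacExponent_eq (hb : b ≠ v₁) : pairVacExponent V S hGR h₁W b = defExponentZero … b + defExponentOne … b + defLambdaExponent … b hb`**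

— the see-saw identity (K-1 `cmPairRepTwist_torusIdeles_cmLineTensorFin`, [Howe1979 §3; GelbartRogawski1991 §3.1 Remark p. 457]) evaluated at
`((archSingle (w b) u)^𝔸, 1)` on the see-saw tensor `φ_N(Φ₀) ⊗″ φ_N(Φ₁)` of the two line vectors `linePhi` ((F1)): the big pair acts by
`det(u)^{pairVacExponent b}` (binder-2 #72's `exists_exponent_of_signs` on theta-3's (BF) Fock image `slotArchBox_follandFock` of the slot box, whose
polynomial lives at `v₁` only), the lines by `cmLineChar₀((archSingle u)^𝔸, 1) · det^{a₀ b} = det^{ℓ_b + a₀ b}` (#CA32, #CA33) and `det^{a₁ b}`; the tensor is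
non-zero (sinst #1213 `cmLineTensorFin_ne_zero`), and `u ↦ det u` takes every unit value on `U(V)(L_b)` (#CA31 `ofStd (D3 z)`), so the exponents agree
(#CA21 `int_eq_zero_of_forall_norm_one_zpow_eq_one`).  Hence at `χV := χVR` (#CA35) binder-2's `hn : nV (w b) = −pairVacExponent b` HOLDS off `v₁`
(`nVR_eq_neg_pairVacExponent`).  0 records, 0 `def … : Prop`, nothing cited as a hypothesis.
-/

set_option autoImplicit false

noncomputable section

open NumberField NumberField.InfinitePlace NumberField.mixedEmbedding IsDedekindDomain
open scoped Matrix Classical TensorProduct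
open ComplexConjugate MvPolynomial
open Literature.NumberTheory.Automorphic Literature.NumberTheory.Automorphic.UnitaryGroup Literature.NumberTheory.Weil1964
open Literature.NumberTheory.GelbartRogawski1991 Literature.NumberTheory.GelbartRogawski1991.UnitaryDualPair
open Literature.RepresentationTheory.KonnoKonno2007
open Literature.RepresentationTheory (atPlace)
open Literature.Analysis.SegalBargmann
open HodgeCM.Adelic HodgeCM.PerL34 HodgeCM.Model.HypCensus HodgeCM.Model.ArchSideTerm HodgeCM.Model.SupplyInstance

namespace HodgeCM.Model

section Sigma

variable {L : CMField} {ι₁ : L →+* ℂ} (V : HermSpace3 L ι₁) (c : SeesawCtx L)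
variable
  (hGR : (cmSplittingDatum (L : Type) finProdFinEquiv (frameD V) (frameD_real V) (frameD_ne V) (dW c.D) (dW_real c.D) (dW_ne c.D)).CompatibleSplitting)
  (hGR₀ : (cmSplittingDatum (L : Type) (e₁) (frameD V) (frameD_real V) (frameD_ne V) (lineVec (L : Type) (dW c.D 0))
    (fun _ => dW_real c.D 0) (fun _ => dW_ne c.D 0)).CompatibleSplitting)
  (hGR₁ : (cmSplittingDatum (L : Type) (e₁) (frameD V) (frameD_real V) (frameD_ne V) (lineVec (L : Type) (dW c.D 1))
    (fun _ => dW_real c.D 1) (fun _ => dW_ne c.D 1)).CompatibleSplitting)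
  (h₁W : (∀ j, 0 < (ι₁ (dW c.D j)).re) ∨ ∀ j, (ι₁ (dW c.D j)).re < 0)
  (hpos₀ : 0 < cmXW (L : Type) (frameD V) (lineVec (L : Type) (dW c.D 0)) (fun _ => dW_real c.D 0) ι₁ (HypCensus.cmPlace (L : Type) ι₁) 0)
  (hpos₁ : 0 < cmXW (L : Type) (frameD V) (lineVec (L : Type) (dW c.D 1)) (fun _ => dW_real c.D 1) ι₁ (HypCensus.cmPlace (L : Type) ι₁) 0)

/-! ## § 1 The big pair on the slot box of the two line vectors -/

include hpos₀ hpos₁ in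
/-- the place polynomial of the slot box lives at `v₁`: its variables avoid every `b ≠ v₁`. -/
theorem vars_slotBoxPoly_ne {b : {v : InfinitePlace ↥(maximalRealSubfield L) // v.IsReal}} (hb : b ≠ HypCensus.cmPlace (L : Type) ι₁) :
    ∀ x ∈ (rename (slotIdx {v : InfinitePlace ↥(maximalRealSubfield L) // v.IsReal})
        (rename Sum.inl (∏ w, rename (atPlace w) (linePlacePoly Empty (L : Type) e₁ (frameD V) (frameD_real V) (lineVec (L : Type) (dW c.D 0))
            (fun _ => dW_real c.D 0) ι₁ (blockPosEquiv V) (blockNegEquiv V) (posIdxEquivUnit hpos₀) (negIdxEquivEmpty hpos₀) (Pi.single 0 1) w)) *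
          rename Sum.inr (∏ w, rename (atPlace w) (linePlacePoly Empty (L : Type) e₁ (frameD V) (frameD_real V) (lineVec (L : Type) (dW c.D 1))
            (fun _ => dW_real c.D 1) ι₁ (blockPosEquiv V) (blockNegEquiv V) (posIdxEquivUnit hpos₁) (negIdxEquivEmpty hpos₁) (Pi.single 0 1) w)))).vars,
      x.2 ≠ b := by
  intro x hx
  obtain ⟨y, hy, rfl⟩ := Finset.mem_image.1 (vars_rename _ _ hx)
  rcases Finset.mem_union.1 (vars_mul _ _ hy) with h | h
  · obtain ⟨z, hz, rfl⟩ := Finset.mem_image.1 (vars_rename _ _ h)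
    exact snd_ne_of_mem_vars_prod_linePlacePoly Empty (L : Type) e₁ (frameD V) (frameD_real V) (lineVec (L : Type) (dW c.D 0))
      (fun _ => dW_real c.D 0) ι₁ (blockPosEquiv V) (blockNegEquiv V) (posIdxEquivUnit hpos₀) (negIdxEquivEmpty hpos₀) (Pi.single 0 1) hb z hz
  · obtain ⟨z, hz, rfl⟩ := Finset.mem_image.1 (vars_rename _ _ h)
    exact snd_ne_of_mem_vars_prod_linePlacePoly Empty (L : Type) e₁ (frameD V) (frameD_real V) (lineVec (L : Type) (dW c.D 1))
      (fun _ => dW_real c.D 1) ι₁ (blockPosEquiv V) (blockNegEquiv V) (posIdxEquivUnit hpos₁) (negIdxEquivEmpty hpos₁) (Pi.single 0 1) hb z hz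

/-- **the big pair acts on the slot box of the two line vectors by `det(u)^{pairVacExponent b}`** (`b ≠ v₁`). -/
theorem cmArchWeilRep_archSingle_slotArchBox_linePhi {b : {v : InfinitePlace ↥(maximalRealSubfield L) // v.IsReal}}
    (hb : b ≠ HypCensus.cmPlace (L : Type) ι₁) (u : archLocal (L : Type) 3 (Matrix.diagonal (frameD V)) (cmPlaceOver (L : Type) b)) :
    cmArchWeilRep (L : Type) finProdFinEquiv (frameD V) (frameD_real V) (frameD_ne V) (dW c.D) (dW_real c.D) (dW_ne c.D) hGR
        (UnitaryGroup.archSingle (↥(maximalRealSubfield L)) L (IsCMField.complexConj L) 3 (Matrix.diagonal (frameD V))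
          (IsCMField.complexConj_ne_one L) (UnitaryGroup.complexConj_smul_infinitePlace (L : Type)) (cmPlaceOver (L : Type) b) u, 1)
        (slotArchBox (linePhi V (dW c.D 0) (dW_real c.D 0) (dW_ne c.D 0) hpos₀) (linePhi V (dW c.D 1) (dW_real c.D 1) (dW_ne c.D 1) hpos₁)) =
      (((u : archLocal (L : Type) 3 (Matrix.diagonal (frameD V)) (cmPlaceOver (L : Type) b)) : GL (Fin 3) ℂ) : Matrix (Fin 3) (Fin 3) ℂ).det ^
          pairVacExponent V c.D hGR h₁W b •
        slotArchBox (linePhi V (dW c.D 0) (dW_real c.D 0) (dW_ne c.D 0) hpos₀) (linePhi V (dW c.D 1) (dW_real c.D 1) (dW_ne c.D 1) hpos₁) := by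
  have hb' : b.1 ≠ (InfinitePlace.mk ι₁).comap (algebraMap (↥(maximalRealSubfield L)) (L : Type)) := fun h => hb (Subtype.ext h)
  rw [linePhi_eq_follandFock, linePhi_eq_follandFock, slotArchBox_follandFock]
  exact (exists_exponent_of_signs (L : Type) finProdFinEquiv (frameD V) (frameD_real V) (frameD_ne V) (dW c.D) (dW_real c.D) (dW_ne c.D) hGR ι₁
    (frameD_sign_ι₁' V) h₁W (frameD_sign_of_ne V)
    (fun τ' _ => signs_fin_two fun j => re_apply_ne_zero_of_complexConj_eq (L : Type) τ' (dW_real c.D j) (dW_ne c.D j))).choose_spec b hb' u _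
    (vars_slotBoxPoly_ne V c hpos₀ hpos₁ hb) _ (schwartzTransport_follandFock _ _)

/-! ## § 2 The line sides at `((archSingle u)^𝔸, 1)` -/

/-- line 0 at a one-place element on the thin-coset test function of `linePhi`: the scalar `det(u)^{ℓ_b} · det(u)^{a₀ b}`. -/
theorem cmLineRepFin₀_one_archSingle_testFun {b : {v : InfinitePlace ↥(maximalRealSubfield L) // v.IsReal}}
    (hb : b ≠ HypCensus.cmPlace (L : Type) ι₁) (u : archLocal (L : Type) 3 (Matrix.diagonal (frameD V)) (cmPlaceOver (L : Type) b))
    (x₀ : Fin 3 → ↥(maximalRealSubfield L)) (N : ℕ) :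
    cmLineRepFin₀ (L : Type) finProdFinEquiv e₁ (frameD V) (frameD_real V) (frameD_ne V) (dW c.D) (dW_real c.D) (dW_ne c.D) hGR hGR₀ hGR₁ 1
        (UnitaryGroup.archToAdelic (↥(maximalRealSubfield L)) L (IsCMField.complexConj L) 3 (Matrix.diagonal (frameD V))
          (UnitaryGroup.archSingle (↥(maximalRealSubfield L)) L (IsCMField.complexConj L) 3 (Matrix.diagonal (frameD V))
            (IsCMField.complexConj_ne_one L) (UnitaryGroup.complexConj_smul_infinitePlace (L : Type)) (cmPlaceOver (L : Type) b) u), 1)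
        (testFun (↥(maximalRealSubfield L)) (Fin 3) (linePhi V (dW c.D 0) (dW_real c.D 0) (dW_ne c.D 0) hpos₀) x₀ N) =
      ((((u : archLocal (L : Type) 3 (Matrix.diagonal (frameD V)) (cmPlaceOver (L : Type) b)) : GL (Fin 3) ℂ) : Matrix (Fin 3) (Fin 3) ℂ).det ^
          defLambdaExponent V c.D hGR hGR₀ hGR₁ h₁W b hb *
        (((u : archLocal (L : Type) 3 (Matrix.diagonal (frameD V)) (cmPlaceOver (L : Type) b)) : GL (Fin 3) ℂ) : Matrix (Fin 3) (Fin 3) ℂ).det ^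
          defExponentZero V c hGR₀ hpos₀ b) •
      testFun (↥(maximalRealSubfield L)) (Fin 3) (linePhi V (dW c.D 0) (dW_real c.D 0) (dW_ne c.D 0) hpos₀) x₀ N := by
  have key := cmPairRep_archToAdelic_eq_adelicTensorEnd (L : Type) e₁ (frameD V) (frameD_real V) (frameD_ne V)
    (lineVec (L : Type) (dW c.D 0)) (fun _ => dW_real c.D 0) (fun _ => dW_ne c.D 0) hGR₀
    (UnitaryGroup.archSingle (↥(maximalRealSubfield L)) L (IsCMField.complexConj L) 3 (Matrix.diagonal (frameD V))
      (IsCMField.complexConj_ne_one L) (UnitaryGroup.complexConj_smul_infinitePlace (L : Type)) (cmPlaceOver (L : Type) b) u) 1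
  rw [map_one] at key
  have key2 := apply_testFun_of_eq_adelicTensorEnd key (linePhi V (dW c.D 0) (dW_real c.D 0) (dW_ne c.D 0) hpos₀) x₀ N
  rw [linePhi_def, defExponentZero_spec V c hGR₀ hpos₀ b hb u, testFun_smul, ← linePhi_def] at key2
  rw [cmLineRepFin₀_apply_eq_smul_cmPairRep, map_one, map_one, MonoidHom.one_apply, one_mul, ← defLambdaChar_apply,
    defLambdaChar_eq_zpow V c.D hGR hGR₀ hGR₁ h₁W b hb u]
  erw [key2]
  rw [smul_smul]

/-- line 1 at a one-place element on the thin-coset test function of `linePhi`: the scalar `det(u)^{a₁ b}`. -/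
theorem cmLineRepFin₁_one_archSingle_testFun {b : {v : InfinitePlace ↥(maximalRealSubfield L) // v.IsReal}}
    (hb : b ≠ HypCensus.cmPlace (L : Type) ι₁) (u : archLocal (L : Type) 3 (Matrix.diagonal (frameD V)) (cmPlaceOver (L : Type) b))
    (x₁ : Fin 3 → ↥(maximalRealSubfield L)) (N : ℕ) :
    cmLineRepFin₁ (L : Type) finProdFinEquiv e₁ (frameD V) (frameD_real V) (frameD_ne V) (dW c.D) (dW_real c.D) (dW_ne c.D) hGR hGR₀ hGR₁ 1
        (UnitaryGroup.archToAdelic (↥(maximalRealSubfield L)) L (IsCMField.complexConj L) 3 (Matrix.diagonal (frameD V))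
          (UnitaryGroup.archSingle (↥(maximalRealSubfield L)) L (IsCMField.complexConj L) 3 (Matrix.diagonal (frameD V))
            (IsCMField.complexConj_ne_one L) (UnitaryGroup.complexConj_smul_infinitePlace (L : Type)) (cmPlaceOver (L : Type) b) u), 1)
        (testFun (↥(maximalRealSubfield L)) (Fin 3) (linePhi V (dW c.D 1) (dW_real c.D 1) (dW_ne c.D 1) hpos₁) x₁ N) =
      (((u : archLocal (L : Type) 3 (Matrix.diagonal (frameD V)) (cmPlaceOver (L : Type) b)) : GL (Fin 3) ℂ) : Matrix (Fin 3) (Fin 3) ℂ).det ^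
          defExponentOne V c hGR₁ hpos₁ b •
      testFun (↥(maximalRealSubfield L)) (Fin 3) (linePhi V (dW c.D 1) (dW_real c.D 1) (dW_ne c.D 1) hpos₁) x₁ N := by
  have key := cmPairRep_archToAdelic_eq_adelicTensorEnd (L : Type) e₁ (frameD V) (frameD_real V) (frameD_ne V)
    (lineVec (L : Type) (dW c.D 1)) (fun _ => dW_real c.D 1) (fun _ => dW_ne c.D 1) hGR₁
    (UnitaryGroup.archSingle (↥(maximalRealSubfield L)) L (IsCMField.complexConj L) 3 (Matrix.diagonal (frameD V))
      (IsCMField.complexConj_ne_one L) (UnitaryGroup.complexConj_smul_infinitePlace (L : Type)) (cmPlaceOver (L : Type) b) u) 1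
  rw [map_one] at key
  have key2 := apply_testFun_of_eq_adelicTensorEnd key (linePhi V (dW c.D 1) (dW_real c.D 1) (dW_ne c.D 1) hpos₁) x₁ N
  rw [linePhi_def, defExponentOne_spec V c hGR₁ hpos₁ b hb u, testFun_smul, ← linePhi_def] at key2
  rw [cmLineRepFin₁_apply_eq_smul_cmPairRep, map_one, map_one, MonoidHom.one_apply, one_mul, cmLineChar₁_apply_mk_one, Units.val_one,
    one_smul]
  erw [key2]

/-! ## § 3 The see-saw comparison and the exponent identity -/

/-- **the see-saw comparison at a one-place element**: `det(u)^{pairVacExponent b} = det(u)^{ℓ_b} · det(u)^{a₀ b} · det(u)^{a₁ b}`. -/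
theorem det_zpow_pairVacExponent_eq {b : {v : InfinitePlace ↥(maximalRealSubfield L) // v.IsReal}}
    (hb : b ≠ HypCensus.cmPlace (L : Type) ι₁) (u : archLocal (L : Type) 3 (Matrix.diagonal (frameD V)) (cmPlaceOver (L : Type) b)) :
    (((u : archLocal (L : Type) 3 (Matrix.diagonal (frameD V)) (cmPlaceOver (L : Type) b)) : GL (Fin 3) ℂ) : Matrix (Fin 3) (Fin 3) ℂ).det ^
        pairVacExponent V c.D hGR h₁W b =
      (((u : archLocal (L : Type) 3 (Matrix.diagonal (frameD V)) (cmPlaceOver (L : Type) b)) : GL (Fin 3) ℂ) : Matrix (Fin 3) (Fin 3) ℂ).det ^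
          defLambdaExponent V c.D hGR hGR₀ hGR₁ h₁W b hb *
        (((u : archLocal (L : Type) 3 (Matrix.diagonal (frameD V)) (cmPlaceOver (L : Type) b)) : GL (Fin 3) ℂ) : Matrix (Fin 3) (Fin 3) ℂ).det ^
          defExponentZero V c hGR₀ hpos₀ b *
        (((u : archLocal (L : Type) 3 (Matrix.diagonal (frameD V)) (cmPlaceOver (L : Type) b)) : GL (Fin 3) ℂ) : Matrix (Fin 3) (Fin 3) ℂ).det ^
          defExponentOne V c hGR₁ hpos₁ b := by
  -- the two line test functions and their (non-zero) see-saw tensor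
  have hφ₀ : testFun (↥(maximalRealSubfield L)) (Fin 3) (linePhi V (dW c.D 0) (dW_real c.D 0) (dW_ne c.D 0) hpos₀) (lineX₀ V (dW c.D 0) (dW_real c.D 0) (dW_ne c.D 0) hpos₀) 1 ≠ 0 :=
    testFun_ne_zero _ (linePhi_archEmb_lineX₀_ne_zero V (dW c.D 0) (dW_real c.D 0) (dW_ne c.D 0) hpos₀) one_ne_zero
  have hφ₁ : testFun (↥(maximalRealSubfield L)) (Fin 3) (linePhi V (dW c.D 1) (dW_real c.D 1) (dW_ne c.D 1) hpos₁) (lineX₀ V (dW c.D 1) (dW_real c.D 1) (dW_ne c.D 1) hpos₁) 1 ≠ 0 :=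
    testFun_ne_zero _ (linePhi_archEmb_lineX₀_ne_zero V (dW c.D 1) (dW_real c.D 1) (dW_ne c.D 1) hpos₁) one_ne_zero
  have hX := cmLineTensorFin_ne_zero V c.D hφ₀ hφ₁
  -- the see-saw restriction at `((archSingle u)^𝔸, diag(1,1))`, trivial twists
  have hss := cmPairRepTwist_torusIdeles_cmLineTensorFin (L : Type) finProdFinEquiv e₁ (frameD V) (frameD_real V) (frameD_ne V) (dW c.D)
    (dW_real c.D) (dW_ne c.D) hGR hGR₀ hGR₁ 1 1 1 (fun _ _ _ => by rw [MonoidHom.one_apply, MonoidHom.one_apply, MonoidHom.one_apply, one_mul])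
    (UnitaryGroup.archToAdelic (↥(maximalRealSubfield L)) L (IsCMField.complexConj L) 3 (Matrix.diagonal (frameD V))
      (UnitaryGroup.archSingle (↥(maximalRealSubfield L)) L (IsCMField.complexConj L) 3 (Matrix.diagonal (frameD V))
      (IsCMField.complexConj_ne_one L) (UnitaryGroup.complexConj_smul_infinitePlace (L : Type)) (cmPlaceOver (L : Type) b) u)) 1 1
    (testFun (↥(maximalRealSubfield L)) (Fin 3) (linePhi V (dW c.D 0) (dW_real c.D 0) (dW_ne c.D 0) hpos₀) (lineX₀ V (dW c.D 0) (dW_real c.D 0) (dW_ne c.D 0) hpos₀) 1) (testFun (↥(maximalRealSubfield L)) (Fin 3) (linePhi V (dW c.D 1) (dW_real c.D 1) (dW_ne c.D 1) hpos₁) (lineX₀ V (dW c.D 1) (dW_real c.D 1) (dW_ne c.D 1) hpos₁) 1)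
  have h11 : cmPlaneTorusIdeles (L : Type) (dW c.D) (1, 1) = 1 := map_one _
  rw [cmPairRepTwist_apply_eq_smul, MonoidHom.one_apply, Units.val_one, one_smul, h11,
    cmLineRepFin₀_one_archSingle_testFun V c hGR hGR₀ hGR₁ h₁W hpos₀ hb u _ 1,
    cmLineRepFin₁_one_archSingle_testFun V c hGR hGR₀ hGR₁ hpos₁ hb u _ 1, LinearMap.map_smul₂, LinearMap.map_smul, smul_smul] at hss
  -- the big side on the same vector
  obtain ⟨f, hXf⟩ := exists_cmLineTensorFin_testFun_eq_tmul V c.D (linePhi V (dW c.D 0) (dW_real c.D 0) (dW_ne c.D 0) hpos₀) (linePhi V (dW c.D 1) (dW_real c.D 1) (dW_ne c.D 1) hpos₁) (lineX₀ V (dW c.D 0) (dW_real c.D 0) (dW_ne c.D 0) hpos₀) (lineX₀ V (dW c.D 1) (dW_real c.D 1) (dW_ne c.D 1) hpos₁) 1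
  have key := cmPairRep_archToAdelic_eq_adelicTensorEnd (L : Type) finProdFinEquiv (frameD V) (frameD_real V) (frameD_ne V) (dW c.D)
    (dW_real c.D) (dW_ne c.D) hGR
    (UnitaryGroup.archSingle (↥(maximalRealSubfield L)) L (IsCMField.complexConj L) 3 (Matrix.diagonal (frameD V))
      (IsCMField.complexConj_ne_one L) (UnitaryGroup.complexConj_smul_infinitePlace (L : Type)) (cmPlaceOver (L : Type) b) u) 1
  rw [map_one] at key
  have hbig := LinearMap.congr_fun key
    (cmLineTensorFin (L : Type) finProdFinEquiv e₁ (frameD V) (frameD_real V) (frameD_ne V) (dW c.D) (dW_real c.D) (dW_ne c.D)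
      (testFun (↥(maximalRealSubfield L)) (Fin 3) (linePhi V (dW c.D 0) (dW_real c.D 0) (dW_ne c.D 0) hpos₀) (lineX₀ V (dW c.D 0) (dW_real c.D 0) (dW_ne c.D 0) hpos₀) 1) (testFun (↥(maximalRealSubfield L)) (Fin 3) (linePhi V (dW c.D 1) (dW_real c.D 1) (dW_ne c.D 1) hpos₁) (lineX₀ V (dW c.D 1) (dW_real c.D 1) (dW_ne c.D 1) hpos₁) 1))
  rw [hXf, adelicTensorEnd_apply_tmul, LinearMap.id_apply,
    cmArchWeilRep_archSingle_slotArchBox_linePhi V c hGR h₁W hpos₀ hpos₁ hb u, ← TensorProduct.smul_tmul', map_smul, ← hXf] at hbig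
  -- compare
  erw [hbig] at hss
  exact smul_left_injective ℂ hX (hss.trans (by ring_nf))

/-- at every definite place `b ≠ v₁` the local group has an element of every unit determinant. -/
theorem exists_archLocal_det_eq {b : {v : InfinitePlace ↥(maximalRealSubfield L) // v.IsReal}} (hb : b ≠ HypCensus.cmPlace (L : Type) ι₁)
    (z : ℂ) (hz : ‖z‖ = 1) :
    ∃ u : archLocal (L : Type) 3 (Matrix.diagonal (frameD V)) (cmPlaceOver (L : Type) b),
      (((u : archLocal (L : Type) 3 (Matrix.diagonal (frameD V)) (cmPlaceOver (L : Type) b)) : GL (Fin 3) ℂ) : Matrix (Fin 3) (Fin 3) ℂ).det = z := by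
  have hzz : conj z * z = 1 := by rw [Complex.conj_mul', hz]; norm_num
  refine ⟨(MulEquiv.subgroupCongr (archLocal_eq_form V b)).symm
    (U3FormChar.ofStd (placeEntries V b) (placeEntries_real V b) (placeEntries_sign V hb) (U3Char.D3 (U21Char.unitOf z hzz))), ?_⟩
  rw [MulEquiv.subgroupCongr_symm_apply]
  change (((U3FormChar.ofStdGL (placeEntries V b) (placeEntries_sign V hb) (U3Char.D3 (U21Char.unitOf z hzz))) : GL (Fin 3) ℂ) :
    Matrix (Fin 3) (Fin 3) ℂ).det = z
  rw [U3FormChar.val_ofStdGL_D3, Matrix.det_diagonal, Fin.prod_univ_three]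
  simp

/-- **(C-Σ-def): at every definite place the pair's vacuum exponent is the sum of the two lines' exponents and the see-saw exponent.** -/
theorem pairVacExponent_eq {b : {v : InfinitePlace ↥(maximalRealSubfield L) // v.IsReal}} (hb : b ≠ HypCensus.cmPlace (L : Type) ι₁) :
    pairVacExponent V c.D hGR h₁W b =
      defExponentZero V c hGR₀ hpos₀ b + defExponentOne V c hGR₁ hpos₁ b + defLambdaExponent V c.D hGR hGR₀ hGR₁ h₁W b hb := by
  have key : ∀ z : ℂ, ‖z‖ = 1 → z ^ (pairVacExponent V c.D hGR h₁W b -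
      (defExponentZero V c hGR₀ hpos₀ b + defExponentOne V c hGR₁ hpos₁ b + defLambdaExponent V c.D hGR hGR₀ hGR₁ h₁W b hb)) = 1 := by
    intro z hz
    have hz0 : z ≠ 0 := norm_ne_zero_iff.mp (by rw [hz]; exact one_ne_zero)
    obtain ⟨u, hu⟩ := exists_archLocal_det_eq V hb z hz
    have h := det_zpow_pairVacExponent_eq V c hGR hGR₀ hGR₁ h₁W hpos₀ hpos₁ hb u
    rw [hu, ← zpow_add₀ hz0, ← zpow_add₀ hz0] at h
    rw [zpow_sub₀ hz0, h, div_eq_one_iff_eq (zpow_ne_zero _ hz0)]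
    congr 1; ring
  have h0 := int_eq_zero_of_forall_norm_one_zpow_eq_one _ key
  omega

/-- **hence binder-2's (V-val) normalisation HOLDS at the read-off type `nVR`**: `nVR (w b) = −pairVacExponent b` for `b ≠ v₁`
(the hypothesis `hn` of #72 `hκ_lettInv_mulSingle_of_type` at `χV := χVR`). -/
theorem nVR_eq_neg_pairVacExponent {b : {v : InfinitePlace ↥(maximalRealSubfield L) // v.IsReal}} (hb : b ≠ HypCensus.cmPlace (L : Type) ι₁) :
    nVR V c hGR hGR₀ hGR₁ h₁W hpos₀ hpos₁ (cmPlaceOver (L : Type) b).1 = -pairVacExponent V c.D hGR h₁W b := by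
  rw [nVR_of_ne V c hGR hGR₀ hGR₁ h₁W hpos₀ hpos₁ hb, pairVacExponent_eq V c hGR hGR₀ hGR₁ h₁W hpos₀ hpos₁ hb]
  ring

end Sigma

end HodgeCM.Model

end
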